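import Summits.ResolutionOfSingularities.ResolutionOfSingularities.Theorems.EquisingularLiftEquisingularLiftNatAffineTwoStepCharts
import Summits.ResolutionOfSingularities.ResolutionOfSingularities.Theorems.EquisingularLiftEquisingularLiftNatTwoStepLocality
import HarnessLib

/-!
# [OURS] THE AFFINE TWO-STEP BRIDGE in the TOWER'S currency (brick B3 of the level-1 bridge): the origin of `Spec K[y]/(Φ + Ψ)` with second-order data is a
# TWO-STEP POINT — every blow-up at it is regular over it except at FINITELY many CLOSED points, each a ONE-STEP point — i.e. LEVEL `1` in every blow-up tower
# (✓ `towerLevel_succ_of_model`; cruxes `Theses.EquisingularLift.EquisingularLiftNat` / `…NatThree` / `EquisingularLift`, stmt-…-20038 / -20148 / -15660)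

[OURS · leafhand-res-equisingularlift-11 g0, 2026-08-31; cell `pub/decomp-res`] AI-produced, weaker than expert review; NOT a statement of any manuscript;
nothing here proves resolution of singularities in positive characteristic.  DEF-FREE helper; no `sorry`; standard axioms; ZERO named hypotheses.

Assembly of this hand's scheme-side bricks: ✓ `OneStep.exists_chart_origin_of_not_isRegularLocalRing` / `finite_setOf_not_isRegularLocalRing` (…NatAffineTwoStepCharts,
p833342), ✓ `OneStep.oneStepAt_origin` (…NatAffineOneStepOrigin, p833029), the chart ring `χ_a : K[T]/(G_a) ≅ (A/(f))[Ī/ȳ_a]` (✓ …NatTwoStepVertexChart, p833140),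
with the transports of leafhand-10 (✓ `PointChain.oneStepAt_of_iso`, ✓ `PointChain.oneStepAt_of_open`) and Mathlib's Jacobson spaces (closed points of the chart
are closed in the blow-up, which is locally of finite type over the Jacobson scheme `Spec K[y]/(f)`):

* `OneStep.isClosed_singleton_chartOrigin` — the image `φ w₀` of the chart origin is a CLOSED point of the blow-up;
* ★★ `OneStep.oneStepAt_chartOrigin` — with second-order data `G_a = Φ'_a + Ψ'_a` (one-step data (hone') at the chart origin, `μ' ≥ 1`), the point
  `φ w₀` is a ONE-STEP point of the blow-up `Z` (tower clause verbatim);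
* (sequel file …NatAffineTwoStepPackage) `OneStep.twoStepAt_origin` — the packaged `hDsucc`-clause at the origin from these two theorems and
  ✓ `finite_setOf_not_isRegularLocalRing`.

What a user still does (S): move from the affine chart `Spec K[y]/(F(x_c := 1)) ≅ D₊(x_c) ∩ V₊(F)` to the projective hypersurface with ✓ `tower_loc` /
✓ `twoStepAt_iff_of_isIso_morphismRestrict` (the chart immersion ✓ `chart F c`), and feed the polynomial second-order data of ✓ …SecondOrder* (`A₃`,
`A`-ladder, `D/E`-ladder).  Honest label: closes no registered stub.

References: [StacksProject, Tags 0804, 02OS, 080E]; [GortzWedhorn2020, Prop. 13.91, (13.19)]; through the cited tree files.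
-/

set_option linter.dupNamespace false -- mandated namespace `Summit.<Summit>.<Problem>` of this single-conjunct summit

noncomputable section

open CategoryTheory CategoryTheory.Limits AlgebraicGeometry TopologicalSpace Topology
open MvPolynomial
open Literature.AlgebraicGeometry.Resolution
open AlgebraicGeometry.Scheme.IdealSheafData
open Summit.ResolutionOfSingularities.ResolutionOfSingularities.Cruxes.EquisingularLiftNat.Sections.ND

namespace Summit.ResolutionOfSingularities.ResolutionOfSingularities.Cruxes.EquisingularLiftNat.Sections

namespace OneStep

variable (K : Type) [Field K] {N : ℕ} (Φ Ψ : MvPolynomial (Fin (N + 1)) K) {μ : ℕ}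

/-- **The chart origin is a closed point of the blow-up.**  `w₀` with ideal `χ((T̄))` (maximal: it is a proper image of the maximal `(T̄)`) is a closed point
of the chart, whose open image in `Z` is locally closed; `Z → Spec K[y]/(f)` is locally of finite type over a Jacobson scheme, so `Z` is a Jacobson space
and locally closed points are closed. [folklore] [cite: StacksProject, Tag 01TB] -/
theorem isClosed_singleton_chartOrigin (a : Fin (N + 1)) (Ga : MvPolynomial (Fin (N + 1)) K)
    (χ : (MvPolynomial (Fin (N + 1)) K ⧸ Ideal.span {Ga}) ≃+*
      blowupAlgebra ((Ideal.span (Set.range (X : Fin (N + 1) → MvPolynomial (Fin (N + 1)) K))).map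
        (Ideal.Quotient.mk (Ideal.span {Φ + Ψ}))) (Ideal.Quotient.mk (Ideal.span {Φ + Ψ}) (X a)))
    {Z : Scheme.{0}} (ρ : Z ⟶ Spec (CommRingCat.of (MvPolynomial (Fin (N + 1)) K ⧸ Ideal.span {Φ + Ψ}))) [LocallyOfFiniteType ρ]
    (φ : Spec (CommRingCat.of (blowupAlgebra ((Ideal.span (Set.range (X : Fin (N + 1) → MvPolynomial (Fin (N + 1)) K))).map
        (Ideal.Quotient.mk (Ideal.span {Φ + Ψ}))) (Ideal.Quotient.mk (Ideal.span {Φ + Ψ}) (X a)))) ⟶ Z) [IsOpenImmersion φ]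
    (w₀ : Spec (CommRingCat.of (blowupAlgebra ((Ideal.span (Set.range (X : Fin (N + 1) → MvPolynomial (Fin (N + 1)) K))).map
        (Ideal.Quotient.mk (Ideal.span {Φ + Ψ}))) (Ideal.Quotient.mk (Ideal.span {Φ + Ψ}) (X a)))))
    (hw₀ : w₀.asIdeal = Ideal.map χ.toRingHom (Ideal.map (Ideal.Quotient.mk (Ideal.span {Ga}))
      (Ideal.span (Set.range (X : Fin (N + 1) → MvPolynomial (Fin (N + 1)) K))))) :
    IsClosed ({w₀} : Set _) ∧ IsClosed ({φ w₀} : Set Z) := by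
  -- `w₀` is a closed point of the chart: its ideal is maximal
  have hTmax := isMaximal_span_range_X' K (N := N)
  have hbar : (Ideal.map (Ideal.Quotient.mk (Ideal.span {Ga}))
      (Ideal.span (Set.range (X : Fin (N + 1) → MvPolynomial (Fin (N + 1)) K)))).IsMaximal := by
    rcases Ideal.map_eq_top_or_isMaximal_of_surjective (Ideal.Quotient.mk (Ideal.span {Ga})) Ideal.Quotient.mk_surjective hTmax with h | h
    · exfalso
      apply w₀.isPrime.ne_top
      rw [hw₀, h, Ideal.map_top]
    · exact h
  have hmax : w₀.asIdeal.IsMaximal := by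
    rw [hw₀]
    exact Ideal.map_isMaximal_of_equiv χ (p := _)
  have hw₀cl : IsClosed ({w₀} : Set _) := (PrimeSpectrum.isClosed_singleton_iff_isMaximal w₀).mpr hmax
  refine ⟨hw₀cl, ?_⟩
  -- `Z` is a Jacobson space
  haveI : JacobsonSpace Z := LocallyOfFiniteType.jacobsonSpace ρ
  refine isClosed_singleton_of_isLocallyClosed_singleton ?_
  rw [← Set.image_singleton]
  exact hw₀cl.isLocallyClosed.image φ.isOpenEmbedding.isInducing φ.isOpenEmbedding.isOpen_range.isLocallyClosed

set_option maxHeartbeats 800000 in -- the chart algebra `blowupAlgebra` is a subalgebra of a localisation: slow instance unification (as in …NatOneStepVertexChart)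
/-- ★★ **THE CHART ORIGIN IS A ONE-STEP POINT OF THE BLOW-UP** when the chart's strict transform carries one-step data at its origin: `G_a = Φ' + Ψ'` with
`Φ' ≠ 0` a form of degree `μ' ≥ 1`, `Ψ' ∈ (T)^{μ'+1}` and (hone') — ✓ `oneStepAt_origin` at the origin of `Spec K[T]/(G_a)`, transported along `Spec χ⁻¹`
(✓ `PointChain.oneStepAt_of_iso`) and the open immersion `φ` (✓ `PointChain.oneStepAt_of_open`). [OURS] [cite: GortzWedhorn2020, Prop. 13.91, (13.19)] -/
theorem oneStepAt_chartOrigin (a : Fin (N + 1)) (Φ' Ψ' : MvPolynomial (Fin (N + 1)) K) {μ' : ℕ} (hμ' : 1 ≤ μ')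
    (hΦ' : Φ'.IsHomogeneous μ') (hΦ'0 : Φ' ≠ 0)
    (hΨ' : Ψ' ∈ Ideal.span (Set.range (X : Fin (N + 1) → MvPolynomial (Fin (N + 1)) K)) ^ (μ' + 1))
    (hone' : ∀ b : Fin (N + 1), ∃ G' : MvPolynomial (Fin (N + 1)) K,
      aeval (fun j => X b * Function.update (X : Fin (N + 1) → MvPolynomial (Fin (N + 1)) K) b 1 j) (Φ' + Ψ') = X b ^ μ' * G' ∧
      ∀ P : Ideal (MvPolynomial (Fin (N + 1)) K), P.IsPrime → (X b : MvPolynomial (Fin (N + 1)) K) ∈ P → G' ∈ P → ∃ j, pderiv j G' ∉ P)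
    (χ : (MvPolynomial (Fin (N + 1)) K ⧸ Ideal.span {Φ' + Ψ'}) ≃+*
      blowupAlgebra ((Ideal.span (Set.range (X : Fin (N + 1) → MvPolynomial (Fin (N + 1)) K))).map
        (Ideal.Quotient.mk (Ideal.span {Φ + Ψ}))) (Ideal.Quotient.mk (Ideal.span {Φ + Ψ}) (X a)))
    {Z : Scheme.{0}} (ρ : Z ⟶ Spec (CommRingCat.of (MvPolynomial (Fin (N + 1)) K ⧸ Ideal.span {Φ + Ψ}))) [LocallyOfFiniteType ρ]
    (φ : Spec (CommRingCat.of (blowupAlgebra ((Ideal.span (Set.range (X : Fin (N + 1) → MvPolynomial (Fin (N + 1)) K))).map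
        (Ideal.Quotient.mk (Ideal.span {Φ + Ψ}))) (Ideal.Quotient.mk (Ideal.span {Φ + Ψ}) (X a)))) ⟶ Z) [IsOpenImmersion φ]
    (w₀ : Spec (CommRingCat.of (blowupAlgebra ((Ideal.span (Set.range (X : Fin (N + 1) → MvPolynomial (Fin (N + 1)) K))).map
        (Ideal.Quotient.mk (Ideal.span {Φ + Ψ}))) (Ideal.Quotient.mk (Ideal.span {Φ + Ψ}) (X a)))))
    (hw₀ : w₀.asIdeal = Ideal.map χ.toRingHom (Ideal.map (Ideal.Quotient.mk (Ideal.span {Φ' + Ψ'}))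
      (Ideal.span (Set.range (X : Fin (N + 1) → MvPolynomial (Fin (N + 1)) K))))) :
    ∃ hz : IsClosed ({φ w₀} : Set Z), ∀ (Z' : Scheme.{0}) (τ' : Z' ⟶ Z), IsBlowup τ' (vanishingIdeal ⟨{φ w₀}, hz⟩) →
      ∀ z' : Z', τ' z' = φ w₀ → IsRegularLocalRing (Z'.presheaf.stalk z') := by
  obtain ⟨hw₀cl, hzcl⟩ := isClosed_singleton_chartOrigin K Φ Ψ a (Φ' + Ψ') χ ρ φ w₀ hw₀
  refine ⟨hzcl, ?_⟩
  -- the origin of `Spec K[T]/(Φ' + Ψ')`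
  let y₀' : Spec (CommRingCat.of (MvPolynomial (Fin (N + 1)) K ⧸ Ideal.span {Φ' + Ψ'})) :=
    ⟨Ideal.map (Ideal.Quotient.mk (Ideal.span {Φ' + Ψ'})) (Ideal.span (Set.range (X : Fin (N + 1) → MvPolynomial (Fin (N + 1)) K))),
      (isMaximal_map_mk_span_range_X K Φ' Ψ' hμ' hΦ' hΨ').isPrime⟩
  have hy₀' : y₀'.asIdeal = Ideal.map (Ideal.Quotient.mk (Ideal.span {Φ' + Ψ'}))
      (Ideal.span (Set.range (X : Fin (N + 1) → MvPolynomial (Fin (N + 1)) K))) := rfl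
  have hy₀'cl : IsClosed ({y₀'} : Set _) :=
    (PrimeSpectrum.isClosed_singleton_iff_isMaximal y₀').mpr (isMaximal_map_mk_span_range_X K Φ' Ψ' hμ' hΦ' hΨ')
  have h1 : ∀ (B : Scheme.{0}) (π : B ⟶ Spec (CommRingCat.of (MvPolynomial (Fin (N + 1)) K ⧸ Ideal.span {Φ' + Ψ'}))),
      IsBlowup π (vanishingIdeal ⟨{y₀'}, hy₀'cl⟩) → ∀ b : B, π b = y₀' → IsRegularLocalRing (B.presheaf.stalk b) :=
    fun B π hπ b hb => oneStepAt_origin K Φ' Ψ' hμ' hΦ' hΦ'0 hΨ' hone' y₀' hy₀' hy₀'cl B π hπ b hb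
  -- across `Spec χ⁻¹ : Spec K[T]/(Φ' + Ψ') ≅ Spec (chart ring)`
  let e₁ : Spec (CommRingCat.of (MvPolynomial (Fin (N + 1)) K ⧸ Ideal.span {Φ' + Ψ'})) ≅
      Spec (CommRingCat.of (blowupAlgebra ((Ideal.span (Set.range (X : Fin (N + 1) → MvPolynomial (Fin (N + 1)) K))).map
        (Ideal.Quotient.mk (Ideal.span {Φ + Ψ}))) (Ideal.Quotient.mk (Ideal.span {Φ + Ψ}) (X a)))) :=
    Scheme.Spec.mapIso (χ.symm.toCommRingCatIso).op
  have he₁ : e₁.hom y₀' = w₀ := by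
    apply PrimeSpectrum.ext
    rw [hw₀]
    change Ideal.comap χ.symm.toRingHom y₀'.asIdeal = _
    rw [hy₀']
    exact Ideal.comap_symm χ
  subst he₁
  have h2 := PointChain.oneStepAt_of_iso e₁ hy₀'cl h1 hw₀cl
  -- along the open immersion `φ = e₂.hom ≫ U.ι`
  let U : Z.Opens := φ.opensRange
  let e₂ := φ.isoOpensRange
  have hφU : ∀ w, U.ι (e₂.hom w) = φ w := fun w => by
    rw [← Scheme.Hom.comp_apply, Scheme.Hom.isoOpensRange_hom_ι]
  have hzU : φ (e₁.hom y₀') ∈ U := ⟨e₁.hom y₀', rfl⟩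
  have hu₀cl : IsClosed ({e₂.hom (e₁.hom y₀')} : Set (U : Scheme.{0})) :=
    PointChain.isClosed_singleton_of_injective U.ι U.ι.isOpenEmbedding.injective (by rw [hφU]; exact hzcl)
  have h3 := PointChain.oneStepAt_of_iso e₂ hw₀cl h2 hu₀cl
  exact PointChain.oneStepAt_of_open U hzU hzcl (e₂.hom (e₁.hom y₀')) (hφU (e₁.hom y₀')) hu₀cl h3

end OneStep

end Summit.ResolutionOfSingularities.ResolutionOfSingularities.Cruxes.EquisingularLiftNat.Sections

end
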